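/-
Copyright (c) 2026. All rights reserved.
Released under Apache 2.0 license as described in the file LICENSE.
Authors: abc-iut cell, seat abc-iut-w4-d095 (gen 6; lineage row «PROP58vii-ARC-GENUINE», brick m1 of the banked census).
-/
import Literature.AnabelianGeometry.AbsoluteAnabelian.TBPlusNonVacuity
import Mathlib.CategoryTheory.Category.Basic
import Mathlib.CategoryTheory.Iso
import HarnessLib

/-!
# [AbsTopIII] Def 5.6 (i): the category structure on `TB⊞` (`TBPlus`, `TBPlus.Hom`)

S. Mochizuki, *Topics in absolute anabelian geometry III*, J. Math. Sci. Univ. Tokyo 22 (2015) [MochizukiAbsTopIII2015];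
manuscript `paper:url-5493eb38cbb7`, Def 5.6 (i) p. 134 l. 26–34 (own render): "Write `TB⊞` for the category whose objects
`(B, B′, B″, β)` consist of a two-dimensional connected topological Lie group `B` equipped with two one-parameter subgroups
`B′, B″ ⊆ B` that determine an isomorphism `B′ × B″ ⥲ B` of topological groups, together with an isomorphism
`β : Lie±(B′) ⥲ Lie±(B″)`, and whose morphisms `(B₁, B′₁, B″₁, β₁) → (B₂, B′₂, B″₂, β₂)` are the surjective homomorphisms
`B₁ → B₂` of topological groups that are compatible with the `B′ᵢ, B″ᵢ, βᵢ` for `i = 1, 2`."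

abc-iut-L4-t3 typed the objects (`TBPlus`) and the morphisms (`TBPlus.Hom`: a surjective continuous homomorphism with the
parameter rescalings `a₁, a₂` of the two one-parameter subgroups and `|a₂|·β₁ = β₂·|a₁|`) in `PanalocalTheaters.lean`, and
abc-iut-w5-d197 / the non-vacuity file `TBPlusNonVacuity.lean` exhibited the genuine model `(ℂ, iℝ, ℝ, 1)` and identity /
negation / composite morphisms — but NO `Category` instance exists, so `TB⊞` cannot yet serve as (a factor of) the target
`𝒩⊢⊞_w` of Prop 5.8 (vii)'s forgetful functors `ψ^{An⊢⊞}_{w,ν}` at an ARCHIMEDEAN `w` (the cell's banked row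
«PROP58vii-ARC-GENUINE», census 2026-08-26: brick m1).  This file supplies exactly that (same doctrine as abc-iut-L6-d6's
`TMMonoGroupoid.lean` for `TM⊢`): `TBPlus.Hom.ext` (a morphism is determined by its homomorphism and its two rescalings —
the remaining fields are propositions), `TBPlus.Hom.id`, `TBPlus.Hom.comp` (rescalings multiply), the `Category TBPlus`
instance with its `rfl`/`simp` bookkeeping, the rescalings as monoid homomorphisms `End → ℝ` in each variable
(`a₁_comp`, `a₂_comp`), `TBPlus.isoMk` (a morphism whose homomorphism is a homeomorphic isomorphism is invertible in `TB⊞`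
when its rescalings are — e.g. the negation), and the forgetful map to topological groups on morphisms.  No new object, no
named fact, no instance beyond the category structure on the already-typed objects/morphisms; the frozen
`PanalocalTheaters.lean` is not edited.  Refereed pre-IUT material; nothing here bears on [IUTchIII] Cor. 3.12; no side taken.
-/

set_option autoImplicit false

universe u

open CategoryTheory

namespace Literature.AnabelianGeometry.AbsoluteAnabelian

namespace TBPlus

variable {M₁ M₂ M₃ : TBPlus.{u}}

/-- Two morphisms of `TB⊞` with the same underlying homomorphism and the same two rescalings are equal (the other fields
are propositions). [cite: MochizukiAbsTopIII2015, Definition 5.6 (i) p.134] -/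
@[ext] theorem Hom.ext {f g : M₁.Hom M₂} (h : f.toHom = g.toHom) (h₁ : f.a₁ = g.a₁) (h₂ : f.a₂ = g.a₂) : f = g := by
  cases f; cases g; cases h; cases h₁; cases h₂; rfl

/-- The identity morphism of an object of `TB⊞` (rescalings `1, 1`). [cite: MochizukiAbsTopIII2015, Definition 5.6 (i) p.134] -/
def Hom.id (M : TBPlus.{u}) : M.Hom M where
  toHom := ContinuousAddMonoidHom.id M.B
  surjective := Function.surjective_id
  a₁ := 1
  a₂ := 1
  map_c₁ s := by simp
  map_c₂ s := by simp
  map_β := by simp [mul_comm]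

/-- Composition of morphisms of `TB⊞`: compose the homomorphisms, multiply the rescalings.
[cite: MochizukiAbsTopIII2015, Definition 5.6 (i) p.134] -/
def Hom.comp (φ : M₁.Hom M₂) (ψ : M₂.Hom M₃) : M₁.Hom M₃ where
  toHom := ψ.toHom.comp φ.toHom
  surjective := ψ.surjective.comp φ.surjective
  a₁ := ψ.a₁ * φ.a₁
  a₂ := ψ.a₂ * φ.a₂
  map_c₁ s := by
    show ψ.toHom (φ.toHom (M₁.c₁ s)) = _
    rw [φ.map_c₁, ψ.map_c₁, mul_assoc]
  map_c₂ s := by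
    show ψ.toHom (φ.toHom (M₁.c₂ s)) = _
    rw [φ.map_c₂, ψ.map_c₂, mul_assoc]
  map_β := by
    have h₁ := φ.map_β
    have h₂ := ψ.map_β
    rw [abs_mul, abs_mul]
    calc |ψ.a₂| * |φ.a₂| * M₁.β = |ψ.a₂| * (|φ.a₂| * M₁.β) := by ring
      _ = |ψ.a₂| * (M₂.β * |φ.a₁|) := by rw [h₁]
      _ = (|ψ.a₂| * M₂.β) * |φ.a₁| := by ring
      _ = (M₃.β * |ψ.a₁|) * |φ.a₁| := by rw [h₂]
      _ = M₃.β * (|ψ.a₁| * |φ.a₁|) := by ring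

/-- **`TB⊞` is a category.** [cite: MochizukiAbsTopIII2015, Definition 5.6 (i) p.134] -/
instance instCategory : Category TBPlus.{u} where
  Hom M N := M.Hom N
  id M := Hom.id M
  comp f g := Hom.comp f g
  id_comp _ := Hom.ext rfl (mul_one _) (mul_one _)
  comp_id _ := Hom.ext rfl (one_mul _) (one_mul _)
  assoc _ _ _ := Hom.ext rfl (mul_assoc _ _ _).symm (mul_assoc _ _ _).symm

/-- The hom-type of the category `TB⊞` is `TBPlus.Hom`. [cite: MochizukiAbsTopIII2015, Definition 5.6 (i) p.134] -/
theorem hom_eq (M N : TBPlus.{u}) : (M ⟶ N) = M.Hom N := rfl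

/-- The identity of `TB⊞` is the identity homomorphism. [cite: MochizukiAbsTopIII2015, Definition 5.6 (i) p.134] -/
@[simp] theorem id_toHom (M : TBPlus.{u}) : (𝟙 M : M.Hom M).toHom = ContinuousAddMonoidHom.id M.B := rfl

/-- The identity has rescalings `1`. [cite: MochizukiAbsTopIII2015, Definition 5.6 (i) p.134] -/
@[simp] theorem id_a₁ (M : TBPlus.{u}) : (𝟙 M : M.Hom M).a₁ = 1 := rfl

/-- The identity has rescalings `1`. [cite: MochizukiAbsTopIII2015, Definition 5.6 (i) p.134] -/
@[simp] theorem id_a₂ (M : TBPlus.{u}) : (𝟙 M : M.Hom M).a₂ = 1 := rfl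

/-- Composition composes the homomorphisms. [cite: MochizukiAbsTopIII2015, Definition 5.6 (i) p.134] -/
@[simp] theorem comp_toHom (f : M₁ ⟶ M₂) (g : M₂ ⟶ M₃) : (f ≫ g).toHom = g.toHom.comp f.toHom := rfl

/-- Composition applied. [cite: MochizukiAbsTopIII2015, Definition 5.6 (i) p.134] -/
theorem comp_toHom_apply (f : M₁ ⟶ M₂) (g : M₂ ⟶ M₃) (x : M₁.B) : (f ≫ g).toHom x = g.toHom (f.toHom x) := rfl

/-- Composition multiplies the `B′`-rescalings. [cite: MochizukiAbsTopIII2015, Definition 5.6 (i) p.134] -/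
@[simp] theorem comp_a₁ (f : M₁ ⟶ M₂) (g : M₂ ⟶ M₃) : (f ≫ g).a₁ = g.a₁ * f.a₁ := rfl

/-- Composition multiplies the `B″`-rescalings. [cite: MochizukiAbsTopIII2015, Definition 5.6 (i) p.134] -/
@[simp] theorem comp_a₂ (f : M₁ ⟶ M₂) (g : M₂ ⟶ M₃) : (f ≫ g).a₂ = g.a₂ * f.a₂ := rfl

/-- The identity acts as the identity. [cite: MochizukiAbsTopIII2015, Definition 5.6 (i) p.134] -/
@[simp] theorem id_toHom_apply (M : TBPlus.{u}) (x : M.B) : (𝟙 M : M.Hom M).toHom x = x := rfl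

/-- The `B′`-rescaling of a morphism is determined by its homomorphism: `c₁` of the target is injective near `0`.
[cite: MochizukiAbsTopIII2015, Definition 5.6 (i) p.134] -/
theorem a₁_eq_of_toHom_eq {f g : M₁ ⟶ M₂} (h : f.toHom = g.toHom) : f.a₁ = g.a₁ := by
  obtain ⟨ε, hε, hinj, -⟩ := M₂.exists_injOn
  -- `M₂.c₁ ((f.a₁ - g.a₁) * s) = 0 = M₂.c₁ 0` for all `s`; take `s` small
  by_contra hne
  have hd : f.a₁ - g.a₁ ≠ 0 := sub_ne_zero.mpr hne
  set s : ℝ := ε / (2 * |f.a₁ - g.a₁|) with hs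
  have hspos : 0 < s := by positivity
  have hmem : (f.a₁ - g.a₁) * s ∈ Set.Ioo (-ε) ε := by
    have habs : |(f.a₁ - g.a₁) * s| = ε / 2 := by
      rw [abs_mul, abs_of_pos hspos, hs]
      field_simp
    constructor
    · nlinarith [neg_abs_le ((f.a₁ - g.a₁) * s)]
    · nlinarith [le_abs_self ((f.a₁ - g.a₁) * s)]
  have h0 : (0 : ℝ) ∈ Set.Ioo (-ε) ε := ⟨by linarith, hε⟩
  have heq : M₂.c₁ ((f.a₁ - g.a₁) * s) = M₂.c₁ 0 := by
    rw [sub_mul, map_sub, map_zero, ← f.map_c₁, ← g.map_c₁, h, sub_self]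
  have := hinj hmem h0 heq
  exact hd (by
    rcases mul_eq_zero.mp this with h1 | h1
    · exact h1
    · exact absurd h1 hspos.ne')

/-- The `B″`-rescaling of a morphism is determined by its homomorphism. [cite: MochizukiAbsTopIII2015, Definition 5.6 (i) p.134] -/
theorem a₂_eq_of_toHom_eq {f g : M₁ ⟶ M₂} (h : f.toHom = g.toHom) : f.a₂ = g.a₂ := by
  obtain ⟨ε, hε, -, hinj⟩ := M₂.exists_injOn
  by_contra hne
  have hd : f.a₂ - g.a₂ ≠ 0 := sub_ne_zero.mpr hne
  set s : ℝ := ε / (2 * |f.a₂ - g.a₂|) with hs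
  have hspos : 0 < s := by positivity
  have hmem : (f.a₂ - g.a₂) * s ∈ Set.Ioo (-ε) ε := by
    have habs : |(f.a₂ - g.a₂) * s| = ε / 2 := by
      rw [abs_mul, abs_of_pos hspos, hs]
      field_simp
    constructor
    · nlinarith [neg_abs_le ((f.a₂ - g.a₂) * s)]
    · nlinarith [le_abs_self ((f.a₂ - g.a₂) * s)]
  have h0 : (0 : ℝ) ∈ Set.Ioo (-ε) ε := ⟨by linarith, hε⟩
  have heq : M₂.c₂ ((f.a₂ - g.a₂) * s) = M₂.c₂ 0 := by
    rw [sub_mul, map_sub, map_zero, ← f.map_c₂, ← g.map_c₂, h, sub_self]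
  have := hinj hmem h0 heq
  exact hd (by
    rcases mul_eq_zero.mp this with h1 | h1
    · exact h1
    · exact absurd h1 hspos.ne')

/-- Hence **a morphism of `TB⊞` is determined by its homomorphism of topological groups** (as in print, where a morphism IS a
homomorphism subject to conditions). [cite: MochizukiAbsTopIII2015, Definition 5.6 (i) p.134] -/
theorem hom_ext_toHom {f g : M₁ ⟶ M₂} (h : f.toHom = g.toHom) : f = g :=
  Hom.ext h (a₁_eq_of_toHom_eq h) (a₂_eq_of_toHom_eq h)

/-- An ISOMORPHISM of `TB⊞` from a morphism whose homomorphism has a continuous two-sided inverse homomorphism compatible with the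
one-parameter subgroups (with the inverse rescalings) — e.g. the negation `x ↦ -x` of `TBPlusNonVacuity.exists_hom_neg`.
[cite: MochizukiAbsTopIII2015, Definition 5.6 (i) p.134] -/
def isoMk (f : M₁ ⟶ M₂) (g : M₂ ⟶ M₁) (hfg : ∀ x, g.toHom (f.toHom x) = x) (hgf : ∀ y, f.toHom (g.toHom y) = y) :
    M₁ ≅ M₂ where
  hom := f
  inv := g
  hom_inv_id := hom_ext_toHom (by ext x; exact hfg x)
  inv_hom_id := hom_ext_toHom (by ext y; exact hgf y)

/-- The rescalings of an isomorphism of `TB⊞` are mutually inverse: `a₁(e⁻¹) · a₁(e) = 1`.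
[cite: MochizukiAbsTopIII2015, Definition 5.6 (i) p.134] -/
theorem Iso.inv_a₁_mul_hom_a₁ (e : M₁ ≅ M₂) : e.inv.a₁ * e.hom.a₁ = 1 := by
  have h := congrArg Hom.a₁ e.hom_inv_id
  rwa [comp_a₁, id_a₁] at h

/-- … and `a₂(e⁻¹) · a₂(e) = 1`. [cite: MochizukiAbsTopIII2015, Definition 5.6 (i) p.134] -/
theorem Iso.inv_a₂_mul_hom_a₂ (e : M₁ ≅ M₂) : e.inv.a₂ * e.hom.a₂ = 1 := by
  have h := congrArg Hom.a₂ e.hom_inv_id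
  rwa [comp_a₂, id_a₂] at h

/-- Every object of `TB⊞` has a NON-identity automorphism: the negation (rescalings `-1`), from `TBPlusNonVacuity.exists_hom_neg`.
[cite: MochizukiAbsTopIII2015, Definition 5.6 (i) p.134] -/
theorem exists_iso_a₁_eq_neg_one (M : TBPlus.{u}) : ∃ e : M ≅ M, e.hom.a₁ = -1 := by
  obtain ⟨φ, hφ, hneg⟩ := exists_hom_neg M
  exact ⟨isoMk φ φ (fun x => by rw [hneg, hneg, neg_neg]) (fun y => by rw [hneg, hneg, neg_neg]), hφ⟩

end TBPlus

end Literature.AnabelianGeometry.AbsoluteAnabelian
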